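import Mathlib
import Literature.NumberTheory.EllipticCurves.BSDInvariantsProofs
import Summits.BirchSwinnertonDyer.BirchSwinnertonDyer.Theorems.Rank2ObservatoryIsoCertificate
import Summits.BirchSwinnertonDyer.BirchSwinnertonDyer.Theorems.Rank2ObservatoryRank2Table

/-!
# Rank-2 observatory — KERNEL-ISO table instrument: one decidable row check ⇒ `rank_ℤ E(ℚ) = 2`

HONEST FRAMING: per-curve certified theorems and census instruments; no claim on BSD in rank ≥ 2.

The TABLE form of the descent-via-`2`-isogeny certificate (`Rank2ObservatoryIsoCertificate.lean`): a census
row with one rational `2`-torsion point becomes a DATA record `IsoRow` (a-invariants, the `2`-torsion abscissa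
datum `e`, and for each of `E₁ = E_{a,b}`, `E₂ = E_{-2a, a²-4b}`: integral point data `(n, m, d)` with
`x = n/d²`, `y = m/d³`; the class list with its product structure; non-residue moduli; the Selmer superset
`D`; kill certificates; the prime list of `b`), and ONE Boolean `IsoRow.check` whose truth (kernel `decide`,
integer arithmetic only — primality by trial division `isPrimeTD`, complete factorisation `factorsOver`)
implies `IsoRow.mordellWeilRank_eq_two : row.curve.mordellWeilRank = 2` UNCONDITIONALLY; plus the census JOIN
(`IsoRow.key`, `censusKey`, `census_rank_of_key_mem`, `key_mem_of_isSublist`) tying rows to `Rank2Row`s of the rank-2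
census by (label, a-invariants). Chunk files `Rank2ObservatoryIsoRowsNNN.lean` carry the rows, the kernel `decide`s
(16 rows per `decide`) and the kernel sublist JOIN against the conductor-matched census chunks.

## References
* J. H. Silverman, J. Tate, *Rational Points on Elliptic Curves*, 2nd ed. (2015), §3.6. [cite: SilvermanTate2015, §3.6]
* J. E. Cremona, *Algorithms for Modular Elliptic Curves*, 2nd ed. (1997), §3.6 (Method 1).
  [cite: CremonaAlgorithms1997, §3.6 (Method 1)]
* J. H. Silverman, *The Arithmetic of Elliptic Curves*, 2nd ed. (2009), III.1, III.3.1(b). [cite: SilvermanAEC2009, III.3.1(b)]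
-/

set_option linter.dupNamespace false

namespace Summit.BirchSwinnertonDyer.BirchSwinnertonDyer.Rank2Observatory.IsoLocal

open Literature.NumberTheory.EllipticCurves WeierstrassCurve
open WeierstrassCurve.Affine (sqClass)

/-! ### Primality by trial division and complete factorisation (kernel-decidable) -/

/-- `tdAux p k fuel`: no `k' ≥ k` with `k'² ≤ p` divides `p` (while the fuel lasts). [folklore] -/
def tdAux (p : ℕ) : ℕ → ℕ → Bool
  | _, 0 => false
  | k, fuel + 1 => if p < k * k then true else (p % k != 0 && tdAux p (k + 1) fuel)

/-- Trial-division primality test. [folklore] -/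
def isPrimeTD (p : ℕ) : Bool := decide (2 ≤ p) && tdAux p 2 p

/-- Soundness of `tdAux`. [folklore] -/
theorem tdAux_sound {p : ℕ} : ∀ (k fuel : ℕ), tdAux p k fuel = true →
    ∀ m, k ≤ m → m * m ≤ p → ¬ m ∣ p
  | k, 0, h => by simp [tdAux] at h
  | k, fuel + 1, h => by
      intro m hkm hmm hdvd
      unfold tdAux at h
      by_cases hlt : p < k * k
      · exact absurd (lt_of_lt_of_le hlt (Nat.mul_le_mul hkm hkm)) (not_lt.mpr hmm)
      · rw [if_neg hlt] at h
        simp only [Bool.and_eq_true, bne_iff_ne, ne_eq] at h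
        rcases Nat.eq_or_lt_of_le hkm with rfl | hlt'
        · exact h.1 (Nat.mod_eq_zero_of_dvd hdvd)
        · exact tdAux_sound (k + 1) fuel h.2 m hlt' hmm hdvd

/-- **`isPrimeTD p = true ⇒ p` prime.** [folklore] -/
theorem prime_of_isPrimeTD {p : ℕ} (h : isPrimeTD p = true) : p.Prime := by
  simp only [isPrimeTD, Bool.and_eq_true, decide_eq_true_eq] at h
  rw [Nat.prime_def_le_sqrt]
  exact ⟨h.1, fun m hm2 hms => tdAux_sound 2 p h.2 m hm2 (Nat.le_sqrt.mp hms)⟩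

/-- Divide out the factor `p` from `n` (fuelled). [folklore] -/
def divideOut (p : ℕ) : ℕ → ℕ → ℕ
  | n, 0 => n
  | n, fuel + 1 => if 2 ≤ p ∧ n ≠ 0 ∧ n % p = 0 then divideOut p (n / p) fuel else n

/-- `divideOut p n fuel · p^k = n` for some `k`. [folklore] -/
theorem exists_divideOut_mul_pow (p : ℕ) : ∀ n fuel : ℕ, ∃ k, divideOut p n fuel * p ^ k = n
  | n, 0 => ⟨0, by simp [divideOut]⟩
  | n, fuel + 1 => by
      unfold divideOut
      split_ifs with hc
      · obtain ⟨k, hk⟩ := exists_divideOut_mul_pow p (n / p) fuel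
        refine ⟨k + 1, ?_⟩
        rw [pow_succ, ← mul_assoc, hk]
        exact Nat.div_mul_cancel (Nat.dvd_of_mod_eq_zero hc.2.2)
      · exact ⟨0, by simp⟩

/-- `n` factors completely over the list `l`: dividing out every entry leaves `1`. [folklore] -/
def factorsOver (n : ℕ) (l : List ℕ) : Bool :=
  l.foldl (fun m p => divideOut p m m) n == 1

/-- Every prime factor of `n` lies in `l`, if `n` factors completely over the primes `l`. [folklore] -/
theorem prime_mem_of_factorsOver : ∀ (l : List ℕ) (n : ℕ), (∀ p ∈ l, p.Prime) →
    l.foldl (fun m p => divideOut p m m) n = 1 → ∀ q : ℕ, q.Prime → q ∣ n → q ∈ l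
  | [], n, _, h, q, hq, hqn => by
      simp only [List.foldl_nil] at h
      subst h
      exact absurd (Nat.le_of_dvd one_pos hqn) (by have := hq.two_le; omega)
  | p :: l, n, hl, h, q, hq, hqn => by
      simp only [List.foldl_cons] at h
      by_cases hqp : q = p
      · exact hqp ▸ List.mem_cons_self
      · refine List.mem_cons_of_mem _ (prime_mem_of_factorsOver l _ (fun r hr => hl r (List.mem_cons_of_mem _ hr))
          h q hq ?_)
        obtain ⟨k, hk⟩ := exists_divideOut_mul_pow p n n
        rw [← hk] at hqn
        rcases (Nat.Prime.dvd_mul hq).mp hqn with h1 | h1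
        · exact h1
        · exact absurd ((Nat.prime_dvd_prime_iff_eq hq (hl p List.mem_cons_self)).mp (hq.dvd_of_dvd_pow h1)) hqp

/-- Corollary in the shape used by the certificate theorem. [folklore] -/
theorem primes_mem_of_factorsOver {b : ℤ} {l : List ℕ} (hl : (l.all isPrimeTD) = true)
    (h : factorsOver b.natAbs l = true) : ∀ q : ℕ, q.Prime → q ∣ b.natAbs → q ∈ l := by
  simp only [factorsOver, beq_iff_eq] at h
  simp only [List.all_eq_true] at hl
  exact prime_mem_of_factorsOver l _ (fun p hp => prime_of_isPrimeTD (hl p hp)) h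

/-! ### Points and classes from integer data -/

/-- Integral point datum: `x = n / d²`, `y = m / d³`. [folklore] -/
structure IsoPt where
  /-- numerator of `x · d²` -/
  n : ℤ
  /-- numerator of `y · d³` -/
  m : ℤ
  /-- the denominator root -/
  d : ℕ
  deriving DecidableEq

/-- The point data are consistent: `d ≠ 0`, `n ≠ 0`, `m² = n³ + a n² d² + b n d⁴`. [folklore] -/
def ptsCheck (a b : ℤ) (pts : List IsoPt) : Bool :=
  pts.all fun P => (P.d != 0) && (P.n != 0) &&
    (P.m ^ 2 == P.n ^ 3 + a * P.n ^ 2 * (P.d : ℤ) ^ 2 + b * P.n * (P.d : ℤ) ^ 4)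

/-- **An integral point datum gives the class `[n] ∈ α(E_{a,b}(ℚ))`.** [cite: SilvermanTate2015, §3.6] -/
theorem sqClass_mem_range_of_data {a b n m : ℤ} {d : ℕ} (hab : b * (a ^ 2 - 4 * b) ≠ 0) (hd : d ≠ 0)
    (hn : n ≠ 0) (h : m ^ 2 = n ^ 3 + a * n ^ 2 * (d : ℤ) ^ 2 + b * n * (d : ℤ) ^ 4) :
    sqClass (n : ℚ) ∈ Set.range (⟨0, (a : ℚ), 0, (b : ℚ), 0⟩ : WeierstrassCurve ℚ).xSqClass := by
  haveI := isElliptic_mk_of_ne_zero (F := ℚ) hab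
  have hd' : (d : ℚ) ≠ 0 := by exact_mod_cast hd
  have hn' : (n : ℚ) ≠ 0 := by exact_mod_cast hn
  have hq : ((m : ℚ) / (d : ℚ) ^ 3) ^ 2 =
      ((n : ℚ) / (d : ℚ) ^ 2) ^ 3 + a * ((n : ℚ) / (d : ℚ) ^ 2) ^ 2 + b * ((n : ℚ) / (d : ℚ) ^ 2) := by
    have h' : ((m : ℚ)) ^ 2 = n ^ 3 + a * n ^ 2 * (d : ℚ) ^ 2 + b * n * (d : ℚ) ^ 4 := by exact_mod_cast h
    field_simp
    linear_combination h'
  have hns : (⟨0, (a : ℚ), 0, (b : ℚ), 0⟩ : WeierstrassCurve ℚ).toAffine.Nonsingular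
      ((n : ℚ) / (d : ℚ) ^ 2) ((m : ℚ) / (d : ℚ) ^ 3) := by
    rw [← WeierstrassCurve.Affine.equation_iff_nonsingular, WeierstrassCurve.Affine.equation_iff]
    simp only [zero_mul, add_zero]
    linear_combination hq
  have hmem := sqClass_mem_range_of_point _ hns (div_ne_zero hn' (pow_ne_zero 2 hd'))
  rwa [sqClass_div_sq hn' hd'] at hmem

/-- The class list `cls` is certified: entry `k` is `1`, `b`, a point abscissa numerator, or the product of
two EARLIER entries named in `prods` (`(k, i, j)`), and every entry is non-zero. [folklore] -/
def clsCheck (b : ℤ) (ptn : List ℤ) (cls : List ℤ) (prods : List (ℕ × ℕ × ℕ)) : Bool :=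
  (List.range cls.length).all fun k =>
    (cls.getD k 0 != 0) && ((cls.getD k 0 == 1) || (cls.getD k 0 == b) || ptn.contains (cls.getD k 0) ||
      prods.any fun t => (t.1 == k) && decide (t.2.1 < k) && decide (t.2.2 < k) &&
        (cls.getD t.2.1 0 * cls.getD t.2.2 0 == cls.getD k 0))

/-- **Soundness of the class list**: every listed class lies in `α(E_{a,b}(ℚ))`. [cite: SilvermanTate2015, §3.6] -/
theorem clsCheck_sound {a b : ℤ} (hab : b * (a ^ 2 - 4 * b) ≠ 0) {ptn cls : List ℤ}
    {prods : List (ℕ × ℕ × ℕ)}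
    (hpt : ∀ v ∈ ptn, sqClass (v : ℚ) ∈ Set.range (⟨0, (a : ℚ), 0, (b : ℚ), 0⟩ : WeierstrassCurve ℚ).xSqClass)
    (h : clsCheck b ptn cls prods = true) :
    ∀ v ∈ cls, sqClass (v : ℚ) ∈ Set.range (⟨0, (a : ℚ), 0, (b : ℚ), 0⟩ : WeierstrassCurve ℚ).xSqClass := by
  haveI := isElliptic_mk_of_ne_zero (F := ℚ) hab
  simp only [clsCheck, List.all_eq_true, List.mem_range, Bool.and_eq_true, Bool.or_eq_true, bne_iff_ne,
    ne_eq, beq_iff_eq, List.any_eq_true, decide_eq_true_eq] at h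
  have key : ∀ k, k < cls.length →
      sqClass ((cls.getD k 0 : ℤ) : ℚ) ∈ Set.range (⟨0, (a : ℚ), 0, (b : ℚ), 0⟩ : WeierstrassCurve ℚ).xSqClass := by
    intro k
    induction k using Nat.strong_induction_on with
    | _ k ih =>
      intro hk
      obtain ⟨h0, h1⟩ := h k hk
      rcases h1 with ((h1 | h1) | h1) | ⟨t, -, ⟨⟨htk, hti⟩, htj⟩, hprod⟩
      · rw [h1]; exact sqClass_intCast_one_mem_range _
      · rw [h1]; exact sqClass_a₄_mem_range _
      · exact hpt _ (List.contains_iff_mem.mp h1)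
      · subst htk
        rw [← hprod, Int.cast_mul]
        exact sqClass_mul_mem_range _ (by exact_mod_cast (h _ (lt_trans hti hk)).1)
          (by exact_mod_cast (h _ (lt_trans htj hk)).1) (ih _ hti (lt_trans hti hk)) (ih _ htj (lt_trans htj hk))
  intro v hv
  obtain ⟨k, hk, rfl⟩ := List.getElem_of_mem hv
  have e1 : cls.getD k 0 = cls[k] := by
    simp [List.getD_eq_getElem?_getD, List.getElem?_eq_getElem hk]
  have := key k hk
  rw [e1] at this
  exact this

/-! ### One side of the certificate -/

/-- Data for one of the two curves `E_{a,b}`. [folklore] -/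
structure IsoSide where
  /-- integral point data -/
  pts : List IsoPt
  /-- class list (values) -/
  cls : List ℤ
  /-- product structure of the class list -/
  prods : List (ℕ × ℕ × ℕ)
  /-- non-residue moduli -/
  Q : List ℕ
  /-- claimed superset of the Selmer group -/
  D : List ℤ
  /-- kill certificates -/
  certs : List (ℤ × (ℕ × ℕ × ℕ))
  /-- the primes of `b` -/
  l : List ℕ
  deriving DecidableEq

/-- The side check. [folklore] -/
def sideCheck (a b : ℤ) (S : IsoSide) : Bool :=
  ptsCheck a b S.pts && clsCheck b (S.pts.map (·.n)) S.cls S.prods && (S.cls.all fun n => n != 0) &&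
    pairwiseNonSquareVia S.Q S.cls && factorsOver b.natAbs S.l && S.l.all isPrimeTD &&
    (S.certs.all fun c => decide (c.2.1 < 2) || isPrimeTD c.2.2.1) && killCheck a b S.D S.certs S.l

/-- **Soundness of one side**: `S(a,b) ⊆ D` and `|cls| ≤ #α(E_{a,b}(ℚ))`. [cite: SilvermanTate2015, §3.6] -/
theorem sideCheck_sound {a b : ℤ} (hab : b * (a ^ 2 - 4 * b) ≠ 0) {S : IsoSide}
    (h : sideCheck a b S = true) :
    twoIsogenySelmerGroup a b ⊆ S.D.toFinset ∧
      S.cls.length ≤ Nat.card (Set.range (⟨0, (a : ℚ), 0, (b : ℚ), 0⟩ : WeierstrassCurve ℚ).xSqClass) := by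
  simp only [sideCheck, Bool.and_eq_true] at h
  obtain ⟨⟨⟨⟨⟨⟨⟨hpts, hcls⟩, hnz⟩, hpair⟩, hfac⟩, hlp⟩, hcp⟩, hkill⟩ := h
  have hb : b ≠ 0 := left_ne_zero_of_mul hab
  have hl := primes_mem_of_factorsOver hlp hfac
  refine ⟨twoIsogenySelmerGroup_subset hb S.l hl S.D.toFinset (killCheck_sound ?_ hkill),
    length_le_natCard_range_xSqClass hab S.cls S.Q hnz hpair (clsCheck_sound hab ?_ hcls)⟩
  · intro c hc hk
    simp only [List.all_eq_true, Bool.or_eq_true, decide_eq_true_eq] at hcp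
    rcases hcp c hc with h1 | h1
    · omega
    · exact prime_of_isPrimeTD h1
  · intro v hv
    obtain ⟨P, hP, rfl⟩ := List.mem_map.mp hv
    simp only [ptsCheck, List.all_eq_true, Bool.and_eq_true, bne_iff_ne, ne_eq, beq_iff_eq] at hpts
    obtain ⟨⟨hd, hn⟩, heq⟩ := hpts P hP
    exact sqClass_mem_range_of_data hab hd hn heq

/-! ### The row, the check, the theorem -/

/-- A KERNEL-ISO certificate row. [folklore] -/
structure IsoRow where
  /-- Cremona label -/
  label : String
  /-- a-invariants of the census model -/
  a₁ : ℤ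
  /-- a-invariant -/
  a₂ : ℤ
  /-- a-invariant -/
  a₃ : ℤ
  /-- a-invariant -/
  a₄ : ℤ
  /-- a-invariant -/
  a₆ : ℤ
  /-- `2`-torsion abscissa datum: `x(T) = e` (unscaled) or `x(T) = e/4` (scaled model) -/
  e : ℤ
  /-- use the scaled model `y² = x³ + b₂x² + 8b₄x + 16b₆` (needed when `a₁` or `a₃` is odd) -/
  scaled : Bool
  /-- data for `E₁` -/
  s₁ : IsoSide
  /-- data for `E₂` -/
  s₂ : IsoSide
  deriving DecidableEq

namespace IsoRow

/-- The census model. [folklore] -/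
def curve (R : IsoRow) : WeierstrassCurve ℚ := ⟨R.a₁, R.a₂, R.a₃, R.a₄, R.a₆⟩

/-- The cubic `x³ + A₂x² + A₄x + A₆` whose root `e` is the `2`-torsion abscissa. [folklore] -/
def A (R : IsoRow) : ℤ × ℤ × ℤ :=
  if R.scaled then (R.a₁ ^ 2 + 4 * R.a₂, 8 * (2 * R.a₄ + R.a₁ * R.a₃), 16 * (R.a₃ ^ 2 + 4 * R.a₆))
  else (R.a₂, R.a₄, R.a₆)

/-- The descent model coefficients `(a, b)`. [folklore] -/
def ab (R : IsoRow) : ℤ × ℤ := (R.A.1 + 3 * R.e, 3 * R.e ^ 2 + 2 * R.A.1 * R.e + R.A.2.1)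

/-- **The row check** (kernel-decidable). [folklore] -/
def check (R : IsoRow) : Bool :=
  (R.scaled || (R.a₁ == 0 && R.a₃ == 0)) &&
  (R.e ^ 3 + R.A.1 * R.e ^ 2 + R.A.2.1 * R.e + R.A.2.2 == 0) &&
  (R.ab.2 * (R.ab.1 ^ 2 - 4 * R.ab.2) != 0) &&
  sideCheck R.ab.1 R.ab.2 R.s₁ && sideCheck (-2 * R.ab.1) (R.ab.1 ^ 2 - 4 * R.ab.2) R.s₂ &&
  decide (Nat.log 2 R.s₁.D.dedup.length + Nat.log 2 R.s₂.D.dedup.length ≤ 2 + 2) &&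
  decide (2 ^ (2 + 1) < R.s₁.cls.length * R.s₂.cls.length)

/-- The scaled change of variables `u = 1/2, r = e/4, s = -a₁/2, t = -(a₃ + e a₁/4)/2`. [folklore] -/
def scaledVC (R : IsoRow) : VariableChange ℚ :=
  ⟨⟨(1/2 : ℚ), 2, by norm_num, by norm_num⟩, (R.e : ℚ) / 4, -(R.a₁ : ℚ) / 2, -((R.a₃ : ℚ) + (R.e : ℚ) / 4 * R.a₁) / 2⟩

/-- Scaled transport: `scaledVC` takes the census model (root `e` of `x³ + b₂x² + 8b₄x + 16b₆`) to `E_{a,b}`.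
[cite: SilvermanAEC2009, III.1 and III.3.1(b)] -/
theorem transport_scaled (R : IsoRow) (hs : R.scaled = true)
    (he : R.e ^ 3 + R.A.1 * R.e ^ 2 + R.A.2.1 * R.e + R.A.2.2 = 0) :
    R.scaledVC • R.curve = ⟨0, (R.ab.1 : ℚ), 0, (R.ab.2 : ℚ), 0⟩ := by
  simp only [A, hs, if_true] at he
  simp only [curve, ab, A, hs, if_true, scaledVC]
  have he' : ((R.e : ℚ)) ^ 3 + (R.a₁ ^ 2 + 4 * R.a₂) * R.e ^ 2 + 8 * (2 * R.a₄ + R.a₁ * R.a₃) * R.e +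
      16 * (R.a₃ ^ 2 + 4 * R.a₆) = 0 := by exact_mod_cast he
  rw [variableChange_def]
  ext <;> push_cast <;> simp <;>
    first | ring1 | linear_combination he' | linear_combination (1 / 64 : ℚ) * he'

/-- Unscaled transport (`a₁ = a₃ = 0`): `x ↦ x + e` takes `y² = x³ + a₂x² + a₄x + a₆` (root `e`) to `E_{a,b}`.
[cite: SilvermanAEC2009, III.3.1(b)] -/
theorem transport_unscaled (R : IsoRow) (hs : R.scaled = false) (h1 : R.a₁ = 0) (h3 : R.a₃ = 0)
    (he : R.e ^ 3 + R.A.1 * R.e ^ 2 + R.A.2.1 * R.e + R.A.2.2 = 0) :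
    (⟨1, (R.e : ℚ), 0, 0⟩ : VariableChange ℚ) • R.curve = ⟨0, (R.ab.1 : ℚ), 0, (R.ab.2 : ℚ), 0⟩ := by
  simp only [A, hs] at he
  simp only [curve, ab, A, hs, h1, h3]
  have he' : ((R.e : ℚ)) ^ 3 + R.a₂ * R.e ^ 2 + R.a₄ * R.e + R.a₆ = 0 := by exact_mod_cast he
  rw [variableChange_def]
  ext <;> push_cast <;> simp <;> first | ring1 | linear_combination he'

/-- Either way there is an admissible change of variables to the descent model. [cite: SilvermanAEC2009, III.3.1(b)] -/
theorem exists_transport (R : IsoRow) (hsc : R.scaled = true ∨ (R.a₁ = 0 ∧ R.a₃ = 0))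
    (he : R.e ^ 3 + R.A.1 * R.e ^ 2 + R.A.2.1 * R.e + R.A.2.2 = 0) :
    ∃ C : VariableChange ℚ, C • R.curve = ⟨0, (R.ab.1 : ℚ), 0, (R.ab.2 : ℚ), 0⟩ := by
  cases hs : R.scaled
  · have h13 : R.a₁ = 0 ∧ R.a₃ = 0 := by simpa [hs] using hsc
    exact ⟨_, transport_unscaled R hs h13.1 h13.2 he⟩
  · exact ⟨_, transport_scaled R hs he⟩

/-- **KERNEL-ISO table theorem: `row.check = true ⇒ rank_ℤ E(ℚ) = 2`** for the row's census model,
unconditionally. [cite: SilvermanTate2015, §3.6] [cite: CremonaAlgorithms1997, §3.6 (Method 1)] -/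
theorem mordellWeilRank_eq_two (R : IsoRow) (h : R.check = true) : R.curve.mordellWeilRank = 2 := by
  simp only [check, Bool.and_eq_true, Bool.or_eq_true, beq_iff_eq, bne_iff_ne, ne_eq,
    decide_eq_true_eq] at h
  obtain ⟨⟨⟨⟨⟨⟨hsc, he⟩, hab⟩, h₁⟩, h₂⟩, hcard⟩, hlen⟩ := h
  obtain ⟨hD₁, hk₁⟩ := sideCheck_sound hab h₁
  obtain ⟨hD₂, hk₂⟩ := sideCheck_sound (twoIsogenyCodomain_ne_zero hab) h₂
  have hE₁ : (⟨0, (R.ab.1 : ℚ), 0, (R.ab.2 : ℚ), 0⟩ : WeierstrassCurve ℚ).mordellWeilRank = 2 := by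
    refine le_antisymm ?_ ?_
    · refine mordellWeilRank_le_of_selmer_subsets hab hD₁ hD₂ ?_
      rwa [List.card_toFinset, List.card_toFinset]
    · exact le_mordellWeilRank_of_classes hab hk₁ (by rw [twoIsogenyCodomain_mk_intCast]; exact hk₂) hlen
  obtain ⟨C, hC⟩ := exists_transport R hsc he
  have ht := mordellWeilRank_variableChange_holds R.curve C
  rw [mordellWeilRank_variableChange, hC] at ht
  rw [← ht]
  exact hE₁

/-- Chunk form: every row of a checked list has rank `2`. [cite: SilvermanTate2015, §3.6] -/
theorem mordellWeilRank_eq_two_of_mem {rows : List IsoRow} (h : ∀ R ∈ rows, R.check = true)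
    {R : IsoRow} (hR : R ∈ rows) : R.curve.mordellWeilRank = 2 :=
  R.mordellWeilRank_eq_two (h R hR)

/-- Chunk form over `List.all` (the shape of the data chunks' kernel theorems). [cite: SilvermanTate2015, §3.6] -/
theorem mordellWeilRank_eq_two_of_all {rows : List IsoRow} (h : rows.all IsoRow.check = true)
    {R : IsoRow} (hR : R ∈ rows) : R.curve.mordellWeilRank = 2 :=
  R.mordellWeilRank_eq_two (List.all_eq_true.mp h R hR)

/-- The census JOIN key of a KERNEL-ISO row: label and a-invariants. [cite: CremonaAlgorithms1997, Tables] -/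
def key (R : IsoRow) : String × ℤ × ℤ × ℤ × ℤ × ℤ := (R.label, R.a₁, R.a₂, R.a₃, R.a₄, R.a₆)

end IsoRow

/-- The JOIN key of a rank-2 census row (`Rank2ObservatoryRank2Table.lean`). [cite: CremonaAlgorithms1997, Tables] -/
def censusKey (r : Rank2Row) : String × ℤ × ℤ × ℤ × ℤ × ℤ := (r.label, r.a₁, r.a₂, r.a₃, r.a₄, r.a₆)

/-- Equal keys ⇒ equal models. [cite: CremonaAlgorithms1997, Tables] -/
theorem curve_eq_of_key_eq {R : IsoRow} {r : Rank2Row} (h : R.key = censusKey r) : r.curve = R.curve := by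
  simp only [IsoRow.key, censusKey, Prod.mk.injEq] at h
  obtain ⟨-, h₁, h₂, h₃, h₄, h₆⟩ := h
  simp only [Rank2Row.curve, IsoRow.curve, h₁, h₂, h₃, h₄, h₆]

/-- JOIN, census direction: a rank-2 census row whose key occurs among checked KERNEL-ISO rows has Mordell–Weil rank
exactly `2` (unconditional). [cite: SilvermanTate2015, §3.6] [cite: CremonaAlgorithms1997, Tables] -/
theorem census_rank_of_key_mem {rows : List IsoRow} (hc : rows.all IsoRow.check = true) {r : Rank2Row}
    (h : censusKey r ∈ rows.map IsoRow.key) : r.curve.mordellWeilRank = 2 := by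
  obtain ⟨R, hR, hk⟩ := List.mem_map.mp h
  rw [curve_eq_of_key_eq hk]
  exact IsoRow.mordellWeilRank_eq_two_of_all hc hR

/-- JOIN, provenance direction: if the keys of `rows` form a sublist of the keys of the census rows `tab` (decidable,
`List.isSublist`, one kernel `decide` per chunk), then every KERNEL-ISO row is — label AND model — a census row.
[cite: CremonaAlgorithms1997, Tables] -/
theorem key_mem_of_isSublist {rows : List IsoRow} {tab : List Rank2Row}
    (h : ((rows.map IsoRow.key).isSublist (tab.map censusKey)) = true) :
    ∀ R ∈ rows, ∃ r ∈ tab, censusKey r = R.key := by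
  have hs := List.isSublist_iff_sublist.mp h
  intro R hR
  have hm : R.key ∈ tab.map censusKey := hs.subset (List.mem_map.mpr ⟨R, hR, rfl⟩)
  obtain ⟨r, hr, hk⟩ := List.mem_map.mp hm
  exact ⟨r, hr, hk⟩

end Summit.BirchSwinnertonDyer.BirchSwinnertonDyer.Rank2Observatory.IsoLocal
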